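import Summits.QuantumFields.YangMills.Theorems.LuscherReductionDressedRitzPolyakovLiftStaticsOfSeparationInstances
import HarnessLib

/-!
# Line «polyakovlift» on crux `DressedRitz` (stmt-QuantumFields-20205), stub S-STAT — the certificate COMPLETED by rotated doublets:
# `PairCertified = PairSeparated ∨ DoubletPair`, and `OneSiteCertifiedAt k → (level-k S-STAT, C = 0)` — the hypothesis of record for the low multiplets

Fleet-service module of seat ym-infvol-p1 g6 (route `LuscherReduction`, femto rung R2b1).  ERRATUM-BY-EXTENSION to `…StaticsOfSeparation.lean` (p545957):
its certificate `PairSeparated` (involution ∕ twirl ∕ symmetric multiplet) does NOT cover a ROTATED basis of an `E`-doublet — the two members of an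
`E`-type level are not related by a group element up to sign, and inside one irreducible isotype no class-function twirl annihilates one member while
reproducing the other; yet (o2)∕(o6) are exact for every basis of a doublet by seat g5's doublet lemma (`l2_dressed_doublet_eq_zero_and_var_eq`,
`l2_iterIns_doublet`: Schur `2 × 2` from ONE axis permutation rotating the pair by an angle with `sn ≠ 0`).  Since an `E⁺` doublet is expected among the
lowest one-site levels, the hypothesis `OneSiteSeparatedAt k` of p545957 would fail there for `k ≥ 2`.  This file adds the missing disjunct:

* `DoubletPair f h` — some axis permutation `c` acts on `(f, h)` by a rotation with `sn ≠ 0`;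
* `PairCertified f h := PairSeparated f h ∨ DoubletPair f h` — the certificate OF RECORD;
* ★ `dressed_pair_eq_zero_of_pairCertified`, ★ `staticClauses_of_pairCertified`, `coreO6_of_pairCertified`;
* `OneSiteCertifiedAt k` and ★★ `liftStatics_level_of_oneSiteCertified : OneSiteCertifiedAt k → (level-k text of Stmt.stub_liftStatics, C = 0)`;
  `oneSiteCertifiedAt_of_separated` (the p545957 hypothesis implies the new one).

With this, every basis of every expected low multiplet is certified: inter-isotype pairs by involutions ∕ twirls, `T`-triplets (any basis) by the
symmetric-multiplet disjunct, `E`-doublets (any basis) by `DoubletPair` (a rotated orthonormal basis of a doublet is again rotated by the 3-cycle with the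
same `sn = ±√3/2 ≠ 0`).  HONEST FRAMING: packaging on the conditional femto rung R2b1; `OneSiteCertifiedAt k` is an OPEN ONE-type statement (isotype
classification of the first `k` one-site levels at large `B₁`), false for large `k`; no renormalisation-group content; nothing here bears on infinite volume,
the continuum limit or the Clay gap.  References: M. Lüscher, NPB 219 (1983) 233, §2 [cite: Luscher1983, §2]; M. Lüscher, G. Münster, NPB 232 (1984) 445
[cite: LuscherMunster1984, §4]; M. Lüscher, U. Wolff, NPB 339 (1990) 222 [cite: LuscherWolff1990].
-/

set_option autoImplicit false

noncomputable section

open MeasureTheory Filter Topology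
open Literature.MathematicalPhysics.QuantumFieldTheory
open scoped BigOperators

namespace Summit.QuantumFields.YangMills.Theorems.FemtoTransferGap.PolyakovLift

open Summit.QuantumFields.YangMills.Theorems.FemtoTransferGap

/-! ## §1 Doublets and the completed certificate -/

/-- **`DoubletPair f h`**: some axis permutation `c ∈ S₃` rotates the pair — `f∘P_c = cs·f + sn·h`, `h∘P_c = −sn·f + cs·h`, `cs² + sn² = 1`, `sn ≠ 0`
(any orthonormal basis of an `E`-type doublet, `c` a 3-cycle, `sn = ±√3/2`). [cite: Luscher1983, §2] -/
def DoubletPair (f h : GaugeConfig 3 1 SU2 → ℝ) : Prop :=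
  ∃ (c : Equiv.Perm (Fin 3)) (cs sn : ℝ), cs ^ 2 + sn ^ 2 = 1 ∧ sn ≠ 0 ∧
    (∀ V, f (configPerm c V) = cs * f V + sn * h V) ∧ (∀ V, h (configPerm c V) = -sn * f V + cs * h V)

/-- **`PairCertified f h`** — the one-site certificate of record: separated (involution ∕ twirl ∕ symmetric multiplet) OR a rotated doublet.
[cite: Luscher1983, §2] -/
def PairCertified (f h : GaugeConfig 3 1 SU2 → ℝ) : Prop :=
  PairSeparated f h ∨ DoubletPair f h

/-- Separated pairs are certified. [folklore] -/
theorem pairCertified_of_separated {f h : GaugeConfig 3 1 SU2 → ℝ} (hs : PairSeparated f h) : PairCertified f h := Or.inl hs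

/-- Doublets are certified. [folklore] -/
theorem pairCertified_of_doublet {f h : GaugeConfig 3 1 SU2 → ℝ} (hd : DoubletPair f h) : PairCertified f h := Or.inr hd

/-- A doublet read in the other order is again a doublet (angle `−θ`). [folklore] -/
theorem DoubletPair.symm {f h : GaugeConfig 3 1 SU2 → ℝ} (hd : DoubletPair f h) : DoubletPair h f := by
  obtain ⟨c, cs, sn, hrot, hsn, h₁, h₂⟩ := hd
  refine ⟨c, cs, -sn, by nlinarith [hrot], neg_ne_zero.mpr hsn, fun V => ?_, fun V => ?_⟩
  · rw [h₂]; ring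
  · rw [h₁]; ring

section Zeros

variable {L : ℕ} [NeZero L]

/-- ★ **Certified channels are exactly uncorrelated and uncoupled** on every fine lattice, for every raw vacuum. [cite: Luscher1983, §2] [cite: LuscherWolff1990] -/
theorem dressed_pair_eq_zero_of_pairCertified (β : ℝ) {φ : GaugeConfig 3 L SU2 → ℝ} (hvac : IsRawVacuum β φ)
    {f h : GaugeConfig 3 1 SU2 → ℝ} (hf : IsPhys f) (hh : IsPhys h) (hc : PairCertified f h) :
    l2 (dressedLiftVec β φ f) (dressedLiftVec β φ h) = 0 ∧ l2 (dressedLiftVec β φ f) (transferApply β (dressedLiftVec β φ h)) = 0 := by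
  rcases hc with hs | ⟨c, cs, sn, hrot, hsn, h₁, h₂⟩
  · exact dressed_pair_eq_zero_of_pairSeparated β hvac hf hh hs
  · have e0 := (l2_iterIns_doublet β hvac.1 hvac.2.2 (flowTime β L) hf hh c hrot hsn (funext h₁) (funext h₂)
      (dressSteps L) (dressSteps L)).1
    have e1 := (l2_iterIns_doublet β hvac.1 hvac.2.2 (flowTime β L) hf hh c hrot hsn (funext h₁) (funext h₂)
      (dressSteps L) (dressSteps L + 1)).1
    rw [Function.iterate_succ_apply'] at e1
    exact ⟨e0, e1⟩

/-- ★ **The static clauses for a pairwise certified lift basis, with ANY `C ≥ 0`.** [cite: Luscher1983, §2] [cite: LuscherWolff1990] -/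
theorem staticClauses_of_pairCertified {lam β : ℝ} (hlam : 0 < lam) (hW : InFemtoWindow lam β L) {φ : GaugeConfig 3 L SU2 → ℝ}
    (hvac : IsRawVacuum β φ) {k : ℕ} {ω : GaugeConfig 3 1 SU2 → ℝ} {g : Fin k → (GaugeConfig 3 1 SU2 → ℝ)}
    (hbasis : LiftBasis (liftCoupling β L) k ω g) (hcert : ∀ i l : Fin k, i ≠ l → PairCertified (g i) (g l)) {C : ℝ} (hC : 0 ≤ C) :
    StaticClauses k C β (dressedLiftFamily β φ g) := by
  have hg : ∀ j, IsPhys (g j) := hbasis.2.2.2.2.1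
  refine ⟨dressedLiftFamily_o0 hlam hW hvac hbasis, fun i l hil => ?_⟩
  have h0 : l2 (dressedLiftFamily β φ g i) (dressedLiftFamily β φ g l) = 0 :=
    (dressed_pair_eq_zero_of_pairCertified β hvac (hg i) (hg l) (hcert i l hil)).1
  rw [h0, abs_zero]
  exact mul_nonneg (mul_nonneg hC (KTRCalibration.luscherLambda_nonneg β L)) (mul_nonneg (Real.sqrt_nonneg _) (Real.sqrt_nonneg _))

/-- ★ **The coupling clause (o6) for a certified pair, with ANY `C ≥ 0`.** [cite: Luscher1983, §2] [cite: LuscherWolff1990] -/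
theorem coreO6_of_pairCertified (β : ℝ) {φ : GaugeConfig 3 L SU2 → ℝ} (hvac : IsRawVacuum β φ)
    {k : ℕ} {ω : GaugeConfig 3 1 SU2 → ℝ} {B : ℝ} {g : Fin k → (GaugeConfig 3 1 SU2 → ℝ)} (hbasis : LiftBasis B k ω g)
    {C : ℝ} (hC : 0 ≤ C) (i l : Fin k) (hcert : PairCertified (g i) (g l)) :
    |l2 (dressedLiftFamily β φ g i) (transferApply β (dressedLiftFamily β φ g l)) -
        (l2 (dressedLiftFamily β φ g i) (transferApply β (dressedLiftFamily β φ g i)) /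
              l2 (dressedLiftFamily β φ g i) (dressedLiftFamily β φ g i) +
            l2 (dressedLiftFamily β φ g l) (transferApply β (dressedLiftFamily β φ g l)) /
              l2 (dressedLiftFamily β φ g l) (dressedLiftFamily β φ g l)) / 2 *
          l2 (dressedLiftFamily β φ g i) (dressedLiftFamily β φ g l)|
      ≤ C * (luscherLambda β L ^ 2 / L) * levelValue su2Rep L β 0 *
          (Real.sqrt (l2 (dressedLiftFamily β φ g i) (dressedLiftFamily β φ g i)) *
            Real.sqrt (l2 (dressedLiftFamily β φ g l) (dressedLiftFamily β φ g l))) := by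
  have hg : ∀ j, IsPhys (g j) := hbasis.2.2.2.2.1
  obtain ⟨h0, h1⟩ := dressed_pair_eq_zero_of_pairCertified β hvac (hg i) (hg l) hcert
  have h0' : l2 (dressedLiftFamily β φ g i) (dressedLiftFamily β φ g l) = 0 := h0
  have h1' : l2 (dressedLiftFamily β φ g i) (transferApply β (dressedLiftFamily β φ g l)) = 0 := h1
  rw [h1', h0', mul_zero, sub_zero, abs_zero]
  have hl0 : 0 ≤ levelValue su2Rep L β 0 := by rw [levelValue_zero]; exact topValue_nonneg su2Rep L β
  exact mul_nonneg (mul_nonneg (mul_nonneg hC (div_nonneg (sq_nonneg _) (Nat.cast_nonneg _))) hl0)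
    (mul_nonneg (Real.sqrt_nonneg _) (Real.sqrt_nonneg _))

end Zeros

/-! ## §2 ★★ S-STAT at a level from the completed certificate -/

/-- **`OneSiteCertifiedAt k`** — ONE-type statement of record: for all `0 < Λ ≤ Λ₀`, every lift basis of the first `k` excited levels of the one-site model
at `B₁ = 2/Λ³` is pairwise certified (`PairCertified`).  Expected TRUE for the low multiplets (`E⁺`, `T₂⁺`, `A₁⁺`), FALSE for large `k` (isotypes repeat).
[cite: Luscher1983, §3] [cite: LuscherMunster1984, §4] -/
def OneSiteCertifiedAt (k : ℕ) : Prop :=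
  ∃ lam0 : ℝ, 0 < lam0 ∧ ∀ Λ : ℝ, 0 < Λ → Λ ≤ lam0 →
    ∀ (ω : GaugeConfig 3 1 SU2 → ℝ) (g : Fin k → (GaugeConfig 3 1 SU2 → ℝ)), LiftBasis (2 / Λ ^ 3) k ω g →
      ∀ i l : Fin k, i ≠ l → PairCertified (g i) (g l)

/-- The separated-only hypothesis of p545957 implies the certificate of record. [folklore] -/
theorem oneSiteCertifiedAt_of_separated {k : ℕ} (h : OneSiteSeparatedAt k) : OneSiteCertifiedAt k := by
  obtain ⟨lam0, hlam0, hk⟩ := h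
  exact ⟨lam0, hlam0, fun Λ hΛ hle ω g hb i l hil => Or.inl (hk Λ hΛ hle ω g hb i l hil)⟩

/-- ★★ **S-STAT at level `k` from the one-site certificate of record, `C = 0`, no renormalisation-group input.** [cite: Luscher1983, §3] [cite: LuscherWolff1990] -/
theorem liftStatics_level_of_oneSiteCertified {k : ℕ} (h : OneSiteCertifiedAt k) :
    ∃ C lam0 : ℝ, 0 ≤ C ∧ 0 < lam0 ∧ ∀ lam : ℝ, 0 < lam → lam ≤ lam0 → ∃ L0 : ℕ,
      ∀ (L : ℕ) [NeZero L], L0 ≤ L → ∀ β : ℝ, InFemtoWindow lam β L →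
        ∀ φ : GaugeConfig 3 L SU2 → ℝ, IsRawVacuum β φ →
          ∀ (ω : GaugeConfig 3 1 SU2 → ℝ) (g : Fin k → (GaugeConfig 3 1 SU2 → ℝ)), LiftBasis (liftCoupling β L) k ω g →
            StaticClauses k C β (dressedLiftFamily β φ g) := by
  obtain ⟨Λ0, hΛ0, hk⟩ := h
  refine ⟨0, Λ0 / 2, le_rfl, by positivity, fun lam hlam hle => ⟨0, fun L _ _ β hW φ hvac ω g hbasis => ?_⟩⟩
  have hΛpos : 0 < luscherLambda β L := luscherLambda_pos_of_window hlam hW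
  have hΛle : luscherLambda β L ≤ Λ0 := hW.2.2.trans (by linarith)
  exact staticClauses_of_pairCertified hlam hW hvac hbasis (hk (luscherLambda β L) hΛpos hΛle ω g hbasis) le_rfl

end Summit.QuantumFields.YangMills.Theorems.FemtoTransferGap.PolyakovLift

end
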